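import Summits.BirchSwinnertonDyer.Rank1Residual.P2.ShuZhaiTwoFiftySixSlices
import Summits.BirchSwinnertonDyer.Rank1Residual.WAll.TargetCMTwoRamifiedTheta
import Literature.NumberTheory.EllipticCurves.Monsky1990.MockHeegnerCongruentNumbers
import Literature.NumberTheory.EllipticCurves.Tian2014.CMPointSystemGenusBridge
import HarnessLib

/-!
# Route `PrintCf2`, crux stmt-BirchSwinnertonDyer-20509 `RamifiedOffTYZOfFacts` — THE SHU–ZHAI TWISTS OF `256c1`
# CARVED OUT OF THE RESIDUAL AND CLOSED BY NAME (beyond `𝔅_ram`: aside 21183); the residual stub REDUCED; the cut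
# COMPOSED with the lead's theta cut (cell `bsd-print-cf2`, seat p2)

HONEST FRAMING (cell `bsd-print-cf2`; route `PrintCf2`; crux 20509 = `𝔅_ram → WAllCornerFTwoRamifiedOffTYZProved`, OPEN;
lead p1's skeleton v3: `stub_offTYZ_uPlusLeaf` / `stub_offTYZ_sMinusLeaf` (landed) / `stub_offTYZ_thetaLeaf` /
`stub_offTYZ_residual := 𝔅_ram → WAllCornerFTwoRamifiedOffTYZOffSMinusOffTheta` (six-way, no print)). This file takes
ONE MORE EXPLICIT INFINITE FAMILY out of the residual: the `ℚ`-isogeny classes of the Shu–Zhai twists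
`256c1^{(−pM)} : y² = x³ + 2p²M²x` (`p ≡ 7 (mod 8)` prime, `M` a product of an even number of distinct primes
`≡ 5 (mod 8)`; leaf `WAllCornerFTwoRamifiedShuZhaiTwoFiftySix` of `WAll/TargetCMTwoRamifiedShuZhaiTwoFiftySix.lean`,
p551803) — the first carve-out that is NOT a congruent-number family (no member model is a model of any `E_n`).
It is closed BY NAME but NOT inside `𝔅_ram`: the closer `wAllCornerFTwoRamifiedShuZhaiTwoFiftySix_of_facts`
(`P2/ShuZhaiTwoFiftySixSlices.lean`) displays Shu–Zhai 2021 Thm 1.2 / Thm 1.4, Agashe–Ribet–Stein 2006 Thm 2.6 and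
the `256c1` base entry `ShuZhai2021.base256c1_optimal_cuspZero` besides conjuncts 2, 3, 4 of `𝔅_ram` — hence the
planner's aside `RamifiedShuZhaiTwoFiftySixOfFactsPlus` (stmt-BirchSwinnertonDyer-21183, K7t doctrine), closed in
`Theorems/PrintCf2RamifiedShuZhaiTwoFiftySixOfFactsPlus.lean`. CONTENTS (no route file imported; stubs stated over
Literature facts and W-ALL leaves verbatim): §1 the leaf from `𝔅_ram` plus the four outside facts, curried
(`shuZhaiTwoFiftySixLeaf_of_bundle`); §2 the five-way residual stub REDUCED to the six-way residual off the
Shu–Zhai classes, granted the four outside facts (`stub_offTYZ_residual_offSMinus_of_offShuZhai`); §3 the cut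
COMPOSED with the lead's theta cut (pure logic, the seven-way residual stated INLINE — naming it is the lead's /
planner's call): `offTYZOffSMinusOffTheta_iff_onShuZhai_off`, `offTYZOffSMinusOffTheta_of_shuZhai_of_off`, and the
crux's conclusion from the full reshaped leaf set (`offTYZProved_of_leaves_of_sevenWay`). Nothing asserted;
conditional on the displayed facts exactly as the items are. Beyond print: NO (Shu–Zhai's printed theorem;
bookkeeping). [cite: ShuZhai2021, Thm. 1.2, Thm. 1.4] [cite: Cremona1997, Table 1 (N = 256, curve C1) and Table 4 (row 256C)]
[cite: AgasheRibetStein2006, Thm. 2.6] [cite: MilneADT2006, Thm. I.7.3] [cite: Miller2011LMS, Def. 1.1]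
-/

noncomputable section

open scoped Classical

open Summit.BirchSwinnertonDyer Summit.BirchSwinnertonDyer.Rank1Residual
  Literature.NumberTheory.EllipticCurves Literature.NumberTheory.EllipticCurves.Rank1Residual
  Literature.NumberTheory.EllipticCurves.ShuZhai2021

set_option autoImplicit false

namespace Summit.BirchSwinnertonDyer.PrintCf2

open Summit.BirchSwinnertonDyer.Rank1Residual.P2

/-! ## §1 The Shu–Zhai `256c1` leaf from `𝔅_ram` and the four facts outside it -/

/-- **The leaf `WAllCornerFTwoRamifiedShuZhaiTwoFiftySix` from `𝔅_ram` (conjuncts 2 modularity, 3 Cassels, 4 row C8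
used) PLUS Shu–Zhai Thm 1.2, Thm 1.4, ARS06 Thm 2.6 and the `256c1` base entry** (curried; the aside 21183 packs
the same five antecedents as one conjunction). [cite: ShuZhai2021, Thm. 1.2 and Thm. 1.4]
[cite: Cremona1997, Table 1 (N = 256, curve C1) and Table 4 (row 256C)] [cite: AgasheRibetStein2006, Thm. 2.6]
[cite: MilneADT2006, Thm. I.7.3] [cite: BurungaleFlach2024, Cor. 2] -/
theorem shuZhaiTwoFiftySixLeaf_of_bundle
    (hB : Literature.NumberTheory.EllipticCurves.rank_eq_analyticRank_of_analyticRank_le_one ∧ WeierstrassCurve.hasEntireLFunction_rat ∧ WeierstrassCurve.bsdRHS_eq_of_isIsogenous ∧ Literature.NumberTheory.EllipticCurves.bsdTriple_of_hasCM_of_L_one_ne_zero ∧ Literature.NumberTheory.EllipticCurves.TianYuanZhang2017.thm12_parity_of_scriptL' ∧ Literature.NumberTheory.EllipticCurves.Tian2014.thm13_rank_one_and_sha_odd ∧ Literature.NumberTheory.QuadraticFields.RedeiReichardt.redeiReichardt_fourTwoCard_classGroup ∧ Literature.NumberTheory.EllipticCurves.LiLiuTian2024.thm12_bsd_congruentNumberCurve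 ∧ Literature.NumberTheory.EllipticCurves.Monsky1990.cor515_rank_eq_one_and_card_selmerGroup_two ∧ Literature.NumberTheory.EllipticCurves.HeathBrown1994.monsky_card_selmerGroup_two_even ∧ Literature.NumberTheory.EllipticCurves.Tian2014.tian2014_system_sMinus_genus)
    (h12 : thm12_ranks_of_twists) (h14 : thm14_twoPartBSD_of_twists)
    (hARS : AgasheRibetStein2006.cremona_abs_maninConstant_eq_one_of_level_le)
    (hbase : base256c1_optimal_cuspZero) : WAllCornerFTwoRamifiedShuZhaiTwoFiftySix :=
  wAllCornerFTwoRamifiedShuZhaiTwoFiftySix_of_facts hB.2.2.1 h12 h14 hB.2.2.2.1 hB.2.1 hARS hbase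

/-! ## §2 The five-way residual stub REDUCED to the six-way residual off the Shu–Zhai classes -/

/-- **Reduction of the residual stub**: granted the four facts outside `𝔅_ram` (SZ Thm 1.2 / 1.4, ARS06, base entry),
a proof of `𝔅_ram → WAllCornerFTwoRamifiedOffTYZOffSMinusOffShuZhai` (six-way residual: off the three TYZ predicates,
off `𝒮⁻` AND off the Shu–Zhai `256c1` classes) yields `𝔅_ram → WAllCornerFTwoRamifiedOffTYZOffSMinus` (five-way).
[folklore] -/
theorem stub_offTYZ_residual_offSMinus_of_offShuZhai (h12 : thm12_ranks_of_twists)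
    (h14 : thm14_twoPartBSD_of_twists) (hARS : AgasheRibetStein2006.cremona_abs_maninConstant_eq_one_of_level_le)
    (hbase : base256c1_optimal_cuspZero)
    (hO : (Literature.NumberTheory.EllipticCurves.rank_eq_analyticRank_of_analyticRank_le_one ∧ WeierstrassCurve.hasEntireLFunction_rat ∧ WeierstrassCurve.bsdRHS_eq_of_isIsogenous ∧ Literature.NumberTheory.EllipticCurves.bsdTriple_of_hasCM_of_L_one_ne_zero ∧ Literature.NumberTheory.EllipticCurves.TianYuanZhang2017.thm12_parity_of_scriptL' ∧ Literature.NumberTheory.EllipticCurves.Tian2014.thm13_rank_one_and_sha_odd ∧ Literature.NumberTheory.QuadraticFields.RedeiReichardt.redeiReichardt_fourTwoCard_classGroup ∧ Literature.NumberTheory.EllipticCurves.LiLiuTian2024.thm12_bsd_congruentNumberCurve ∧ Literature.NumberTheory.EllipticCurves.Monsky1990.cor515_rank_eq_one_and_card_selmerGroup_two ∧ Literature.NumberTheory.EllipticCurves.HeathBrown1994.monsky_card_selmerGroup_two_even ∧ Literature.NumberTheory.EllipticCurves.Tian2014.tian2014_system_sMinus_genus) → Summit.BirchSwinnertonDyer.WAllCornerFTwoRamifiedOffTYZOffSMinusOffShuZhai)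 :
    (Literature.NumberTheory.EllipticCurves.rank_eq_analyticRank_of_analyticRank_le_one ∧ WeierstrassCurve.hasEntireLFunction_rat ∧ WeierstrassCurve.bsdRHS_eq_of_isIsogenous ∧ Literature.NumberTheory.EllipticCurves.bsdTriple_of_hasCM_of_L_one_ne_zero ∧ Literature.NumberTheory.EllipticCurves.TianYuanZhang2017.thm12_parity_of_scriptL' ∧ Literature.NumberTheory.EllipticCurves.Tian2014.thm13_rank_one_and_sha_odd ∧ Literature.NumberTheory.QuadraticFields.RedeiReichardt.redeiReichardt_fourTwoCard_classGroup ∧ Literature.NumberTheory.EllipticCurves.LiLiuTian2024.thm12_bsd_congruentNumberCurve ∧ Literature.NumberTheory.EllipticCurves.Monsky1990.cor515_rank_eq_one_and_card_selmerGroup_two ∧ Literature.NumberTheory.EllipticCurves.HeathBrown1994.monsky_card_selmerGroup_two_even ∧ Literature.NumberTheory.EllipticCurves.Tian2014.tian2014_system_sMinus_genus) → Summit.BirchSwinnertonDyer.WAllCornerFTwoRamifiedOffTYZOffSMinus :=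
  fun hB ↦ wAllCornerFTwoRamifiedOffTYZOffSMinus_of_shuZhai_of_offShuZhai
    (shuZhaiTwoFiftySixLeaf_of_bundle hB h12 h14 hARS hbase) (hO hB)

/-! ## §3 The cut composed with the lead's theta cut (skeleton v3 of crux 20509): the seven-way residual, inline -/

/-- **The lead's six-way residual `WAllCornerFTwoRamifiedOffTYZOffSMinusOffTheta` ⟺ its Shu–Zhai part ∧ the SEVEN-WAY
residual** (off TYZProved, U⁺, AtlasFJ, `𝒮⁻`, theta AND the Shu–Zhai `256c1` classes; stated inline) — EXACT, pure
logic. [folklore] -/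
theorem offTYZOffSMinusOffTheta_iff_onShuZhai_off :
    WAllCornerFTwoRamifiedOffTYZOffSMinusOffTheta ↔
      (∀ (W : WeierstrassCurve ℚ) [W.IsElliptic] [W.IsGloballyMinimal],
          W.HasCM → W.analyticRank = 1 → CMRamified W 2 → ¬ CongruentTYZProvedFamily W →
            ¬ CongruentTYZUPlusFamily W → ¬ CongruentTYZAtlasFJFamily W → ¬ CongruentMonskySMinusFamily W →
            ¬ CongruentThetaFamily W → IsIsogenousToShuZhaiTwoFiftySixTwist W → BSDp W 2) ∧
      (∀ (W : WeierstrassCurve ℚ) [W.IsElliptic] [W.IsGloballyMinimal],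
          W.HasCM → W.analyticRank = 1 → CMRamified W 2 → ¬ CongruentTYZProvedFamily W →
            ¬ CongruentTYZUPlusFamily W → ¬ CongruentTYZAtlasFJFamily W → ¬ CongruentMonskySMinusFamily W →
            ¬ CongruentThetaFamily W → ¬ IsIsogenousToShuZhaiTwoFiftySixTwist W → BSDp W 2) := by
  constructor
  · intro h
    exact ⟨fun W _ _ hcm hr1 hram h1 h2 h3 h4 h5 _ ↦ h W hcm hr1 hram h1 h2 h3 h4 h5,
      fun W _ _ hcm hr1 hram h1 h2 h3 h4 h5 _ ↦ h W hcm hr1 hram h1 h2 h3 h4 h5⟩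
  · rintro ⟨hS, hO⟩ W _ _ hcm hr1 hram h1 h2 h3 h4 h5
    by_cases h6 : IsIsogenousToShuZhaiTwoFiftySixTwist W
    · exact hS W hcm hr1 hram h1 h2 h3 h4 h5 h6
    · exact hO W hcm hr1 hram h1 h2 h3 h4 h5 h6

/-- **The lead's six-way residual from the Shu–Zhai `256c1` leaf and the seven-way residual** — the registered
`stub_offTYZ_residual` of skeleton v3 REDUCES to the seven-way residual once aside 21183 supplies the leaf.
[folklore] -/
theorem offTYZOffSMinusOffTheta_of_shuZhai_of_off (hZ : WAllCornerFTwoRamifiedShuZhaiTwoFiftySix)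
    (hO : ∀ (W : WeierstrassCurve ℚ) [W.IsElliptic] [W.IsGloballyMinimal],
          W.HasCM → W.analyticRank = 1 → CMRamified W 2 → ¬ CongruentTYZProvedFamily W →
            ¬ CongruentTYZUPlusFamily W → ¬ CongruentTYZAtlasFJFamily W → ¬ CongruentMonskySMinusFamily W →
            ¬ CongruentThetaFamily W → ¬ IsIsogenousToShuZhaiTwoFiftySixTwist W → BSDp W 2) :
    WAllCornerFTwoRamifiedOffTYZOffSMinusOffTheta :=
  offTYZOffSMinusOffTheta_iff_onShuZhai_off.2 ⟨fun W _ _ hcm hr1 hram _ _ _ _ _ h6 ↦ hZ W hcm hr1 hram h6, hO⟩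

/-- The seven-way residual is a restriction of the lead's six-way residual. [folklore] -/
theorem sevenWay_of_offTYZOffSMinusOffTheta (h : WAllCornerFTwoRamifiedOffTYZOffSMinusOffTheta) :
    ∀ (W : WeierstrassCurve ℚ) [W.IsElliptic] [W.IsGloballyMinimal],
      W.HasCM → W.analyticRank = 1 → CMRamified W 2 → ¬ CongruentTYZProvedFamily W →
        ¬ CongruentTYZUPlusFamily W → ¬ CongruentTYZAtlasFJFamily W → ¬ CongruentMonskySMinusFamily W →
        ¬ CongruentThetaFamily W → ¬ IsIsogenousToShuZhaiTwoFiftySixTwist W → BSDp W 2 :=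
  (offTYZOffSMinusOffTheta_iff_onShuZhai_off.1 h).2

/-- … and of p2's six-way residual `WAllCornerFTwoRamifiedOffTYZOffSMinusOffShuZhai` (the two cuts commute).
[folklore] -/
theorem sevenWay_of_offTYZOffSMinusOffShuZhai (h : WAllCornerFTwoRamifiedOffTYZOffSMinusOffShuZhai) :
    ∀ (W : WeierstrassCurve ℚ) [W.IsElliptic] [W.IsGloballyMinimal],
      W.HasCM → W.analyticRank = 1 → CMRamified W 2 → ¬ CongruentTYZProvedFamily W →
        ¬ CongruentTYZUPlusFamily W → ¬ CongruentTYZAtlasFJFamily W → ¬ CongruentMonskySMinusFamily W →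
        ¬ CongruentThetaFamily W → ¬ IsIsogenousToShuZhaiTwoFiftySixTwist W → BSDp W 2 :=
  fun W _ _ hcm hr1 hram h1 h2 h3 h4 _ h6 ↦ h W hcm hr1 hram h1 h2 h3 h4 h6

/-- **The crux's conclusion `WAllCornerFTwoRamifiedOffTYZProved` from the FULL reshaped leaf set**: U⁺-road leaf,
FJ-atlas leaf, `𝒮⁻` leaf, theta leaf, Shu–Zhai `256c1` leaf, and the seven-way residual (excluded middle only).
[folklore] -/
theorem offTYZProved_of_leaves_of_sevenWay (hU : WAllCornerFTwoRamifiedTYZUPlus) (hF : WAllCornerFTwoRamifiedTYZAtlasFJ)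
    (hS : WAllCornerFTwoRamifiedSMinus) (hT : WAllCornerFTwoRamifiedTheta) (hZ : WAllCornerFTwoRamifiedShuZhaiTwoFiftySix)
    (hO : ∀ (W : WeierstrassCurve ℚ) [W.IsElliptic] [W.IsGloballyMinimal],
          W.HasCM → W.analyticRank = 1 → CMRamified W 2 → ¬ CongruentTYZProvedFamily W →
            ¬ CongruentTYZUPlusFamily W → ¬ CongruentTYZAtlasFJFamily W → ¬ CongruentMonskySMinusFamily W →
            ¬ CongruentThetaFamily W → ¬ IsIsogenousToShuZhaiTwoFiftySixTwist W → BSDp W 2) :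
    WAllCornerFTwoRamifiedOffTYZProved :=
  wAllCornerFTwoRamifiedOffTYZProved_of_uPlus_of_atlasFJ_of_sMinus_of_theta_of_off hU hF hS hT
    (offTYZOffSMinusOffTheta_of_shuZhai_of_off hZ hO)

/-- **The same with the Shu–Zhai leaf supplied by the facts** (`𝔅_ram` + SZ12 + SZ14 + ARS06 + base entry): the crux
`RamifiedOffTYZOfFacts` then needs exactly the U⁺ leaf (aside 20471, LITERAL), the FJ-atlas leaf (landed), the
`𝒮⁻` leaf (landed), the theta leaf (aside 21185) and the seven-way residual (OPEN, no print).
[cite: ShuZhai2021, Thm. 1.2 and Thm. 1.4] [cite: AgasheRibetStein2006, Thm. 2.6] -/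
theorem offTYZProved_of_bundle_of_leaves_of_sevenWay
    (hB : Literature.NumberTheory.EllipticCurves.rank_eq_analyticRank_of_analyticRank_le_one ∧ WeierstrassCurve.hasEntireLFunction_rat ∧ WeierstrassCurve.bsdRHS_eq_of_isIsogenous ∧ Literature.NumberTheory.EllipticCurves.bsdTriple_of_hasCM_of_L_one_ne_zero ∧ Literature.NumberTheory.EllipticCurves.TianYuanZhang2017.thm12_parity_of_scriptL' ∧ Literature.NumberTheory.EllipticCurves.Tian2014.thm13_rank_one_and_sha_odd ∧ Literature.NumberTheory.QuadraticFields.RedeiReichardt.redeiReichardt_fourTwoCard_classGroup ∧ Literature.NumberTheory.EllipticCurves.LiLiuTian2024.thm12_bsd_congruentNumberCurve ∧ Literature.NumberTheory.EllipticCurves.Monsky1990.cor515_rank_eq_one_and_card_selmerGroup_two ∧ Literature.NumberTheory.EllipticCurves.HeathBrown1994.monsky_card_selmerGroup_two_even ∧ Literature.NumberTheory.EllipticCurves.Tian2014.tian2014_system_sMinus_genus)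
    (h12 : thm12_ranks_of_twists) (h14 : thm14_twoPartBSD_of_twists)
    (hARS : AgasheRibetStein2006.cremona_abs_maninConstant_eq_one_of_level_le) (hbase : base256c1_optimal_cuspZero)
    (hU : WAllCornerFTwoRamifiedTYZUPlus) (hF : WAllCornerFTwoRamifiedTYZAtlasFJ) (hS : WAllCornerFTwoRamifiedSMinus)
    (hT : WAllCornerFTwoRamifiedTheta)
    (hO : ∀ (W : WeierstrassCurve ℚ) [W.IsElliptic] [W.IsGloballyMinimal],
          W.HasCM → W.analyticRank = 1 → CMRamified W 2 → ¬ CongruentTYZProvedFamily W →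
            ¬ CongruentTYZUPlusFamily W → ¬ CongruentTYZAtlasFJFamily W → ¬ CongruentMonskySMinusFamily W →
            ¬ CongruentThetaFamily W → ¬ IsIsogenousToShuZhaiTwoFiftySixTwist W → BSDp W 2) :
    WAllCornerFTwoRamifiedOffTYZProved :=
  offTYZProved_of_leaves_of_sevenWay hU hF hS hT (shuZhaiTwoFiftySixLeaf_of_bundle hB h12 h14 hARS hbase) hO

/-! ## §4 The isogeny-class leaf implies the planner's PREDICATE form (aside 21183's consequent) -/

/-- **Leaf ⟹ aside consequent**: the W-ALL leaf `WAllCornerFTwoRamifiedShuZhaiTwoFiftySix` (isogeny classes, clause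
`#Q % 2 = 0`) implies the consequent of the planner's aside `RamifiedShuZhaiTwoFiftySixOfFactsPlus`
(stmt-BirchSwinnertonDyer-21183; ℚ-MODELS, clause `∏ q ≡ 1 (mod 8)`) — a model is isogenous to the twist, and under
`q ≡ 5 (mod 8)` the two parity clauses agree (`P2.card_mod_two_eq_zero_iff_prod_mod_eight_eq_one`). The converse needs
Cassels (the class also contains the models of `y² = x³ − 8p²M²x`). [cite: ShuZhai2021, Thm. 1.2, Def. 1.1 and Thm. 1.4 (ii)] -/
theorem shuZhaiTwoFiftySixModels_of_leaf (hZ : WAllCornerFTwoRamifiedShuZhaiTwoFiftySix) :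
    ∀ (W : WeierstrassCurve ℚ) [W.IsElliptic] [W.IsGloballyMinimal], W.HasCM → W.analyticRank = 1 →
      CMRamified W 2 →
      (∃ (p : ℕ) (Q : Finset ℕ) (C : WeierstrassCurve.VariableChange ℚ), p.Prime ∧ p % 8 = 7 ∧
        (∀ q ∈ Q, q.Prime ∧ q % 8 = 5) ∧ (∏ q ∈ Q, q) % 8 = 1 ∧
        C • curve256c1.quadraticTwist (-((p * ∏ q ∈ Q, q : ℕ) : ℚ)) = W) → BSDp W 2 := by
  intro W _ _ hcm hr1 hram hW
  obtain ⟨p, Q, C, hp, h8, hQ, hM, hC⟩ := hW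
  exact hZ W hcm hr1 hram (isIsogenousToShuZhaiTwoFiftySixTwist_of_isShuZhaiTwoFiftySixTwist
    ⟨p, Q, C, hp, h8, hQ, (card_mod_two_eq_zero_iff_prod_mod_eight_eq_one hQ).2 hM, hC⟩)

/-- **Conversely, a model in the planner's clause is a member of p2's predicate** (`∏ q ≡ 1 (8)` ⟹ `#Q` even), so the
aside's MEMBER set is contained in `P2.IsShuZhaiTwoFiftySixTwist` ⊂ `P2.IsIsogenousToShuZhaiTwoFiftySixTwist`.
[cite: ShuZhai2021, Def. 1.1 and Thm. 1.4 (ii)] -/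
theorem isShuZhaiTwoFiftySixTwist_of_prodModEight {W : WeierstrassCurve ℚ}
    (hW : ∃ (p : ℕ) (Q : Finset ℕ) (C : WeierstrassCurve.VariableChange ℚ), p.Prime ∧ p % 8 = 7 ∧
        (∀ q ∈ Q, q.Prime ∧ q % 8 = 5) ∧ (∏ q ∈ Q, q) % 8 = 1 ∧
        C • curve256c1.quadraticTwist (-((p * ∏ q ∈ Q, q : ℕ) : ℚ)) = W) :
    IsShuZhaiTwoFiftySixTwist W := by
  obtain ⟨p, Q, C, hp, h8, hQ, hM, hC⟩ := hW
  exact ⟨p, Q, C, hp, h8, hQ, (card_mod_two_eq_zero_iff_prod_mod_eight_eq_one hQ).2 hM, hC⟩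

end Summit.BirchSwinnertonDyer.PrintCf2

end
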